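import Summits.Ventures.PercRepro.Night2FatZOneB
import Summits.Ventures.PercRepro.Night2FatZSix

/-!
# night-2: exactly one basis point on the spine (C) — the unique off-spine point of a plane; `N = 6`

When `y₂` is the only point of `W ∖ {x}` in `π₂` off the spine, a basis line through it carries at most one other point
of `W ∖ {x}` (`card_line_through_off_spine_le_one`); off the basis lines it is free (`dload_eq_zero_through_free_off_spine`);
`N = 6`: the six pairs `{y₂, s, s'} × {q, q'}` and the levels `4, 5, 6` (`basis_pair_fair_fat_of_two_planes_one_six`, `1.121`).
Paper `proofs/NIGHT-2-g34.md` §6 (b).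
-/

namespace PercRepro.Shadow

open PercRepro.ThmH PercRepro.PerFlat

variable {α : Type*} [DecidableEq α] {M : Matroid α} [M.Finite] {G : Finset α}

/-- **When `y₂` is the only point of `W ∖ {x}` in `π₂` off the spine, a basis line through `y₂` carries at most one
other point of `W ∖ {x}`**: two such points lie in `π₂`, hence on the spine, and the line would be the spine. -/
theorem card_line_through_off_spine_le_one (hG : G ∈ flatsQ M (5 + 1)) (hd : (gr M \ G).card = 2)
    (hs : ∀ e ∈ gr M, ∀ f ∈ gr M, e ≠ f → rkN M {e, f} = 2) {w₀ x : α} {R₁ : Finset α}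
    (hR₁V : R₁ ⊆ (G \ coloops M G) \ {w₀, x}) (hR₁2 : rkN M R₁ = 2) {c₂ c₃ : α}
    (hc₂V : c₂ ∈ (G \ coloops M G) \ {w₀, x}) (hc₃V : c₃ ∈ (G \ coloops M G) \ {w₀, x})
    (hc₂ : c₂ ∉ clF M R₁) (hc₃ : c₃ ∉ clF M (insert c₂ R₁))
    (hcover : ∀ e ∈ (G \ coloops M G) \ {w₀, x}, e ∈ clF M (insert c₂ R₁) ∨ e ∈ clF M (insert c₃ R₁))
    {B : Finset α} (hB : B ∈ thinMembers M 5 G) {z : α} (hz : z ∈ G \ clF M B)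
    (hw₀ : w₀ ∈ insert z B) (hx : x ∈ G \ insert z B) {y₂ : α} (hy₂ : y₂ ∈ (G \ insert z B).erase x)
    (hy₂2 : y₂ ∈ clF M (insert c₂ R₁)) (hy₂L : y₂ ∉ clF M R₁)
    (hA1 : ∀ u ∈ (G \ insert z B).erase x, u ∈ clF M (insert c₂ R₁) → u ∉ clF M R₁ → u = y₂)
    {p q : α} (hp : p ∈ (insert z B \ coloops M G).erase w₀) (hq : q ∈ (insert z B \ coloops M G).erase w₀)
    (hpq : p ≠ q) (hline : rkN M {p, q, y₂} ≤ 2) :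
    ((((G \ insert z B).erase x).filter (fun y => rkN M (insert y {p, q}) ≤ 2)).erase y₂).card ≤ 1 := by
  have hd' : (gr M \ G).card ≤ 5 := by omega
  have hGg : G ⊆ gr M := (mem_flatsQ.1 hG).1
  have hQG : insert z B ⊆ G :=
    Finset.insert_subset (Finset.mem_sdiff.1 hz).1 (subset_G_of_mem_thinMembers hB)
  have hKQ : coloops M G ⊆ insert z B :=
    (coloops_subset_of_mem_thinMembers hG hd' hB).trans (Finset.subset_insert _ _)
  have hxQ : x ∉ insert z B := (Finset.mem_sdiff.1 hx).2
  have hVg : (G \ coloops M G) \ {w₀, x} ⊆ gr M := fun e he =>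
    hGg (Finset.mem_sdiff.1 (Finset.mem_sdiff.1 he).1).1
  have hR₁g : R₁ ⊆ gr M := hR₁V.trans hVg
  have hc₂g : c₂ ∈ gr M := hVg hc₂V
  have hc₃g : c₃ ∈ gr M := hVg hc₃V
  have hWV : ∀ u ∈ (G \ insert z B).erase x, u ∈ (G \ coloops M G) \ {w₀, x} := by
    intro u hu
    rw [Finset.mem_erase, Finset.mem_sdiff] at hu
    rw [Finset.mem_sdiff, Finset.mem_sdiff, Finset.mem_insert, Finset.mem_singleton]
    refine ⟨⟨hu.2.1, fun h' => hu.2.2 (hKQ h')⟩, ?_⟩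
    rintro (rfl | rfl)
    · exact hu.2.2 hw₀
    · exact hu.1 rfl
  have hP₀V : ∀ u ∈ (insert z B \ coloops M G).erase w₀, u ∈ (G \ coloops M G) \ {w₀, x} := by
    intro u hu
    rw [Finset.mem_erase, Finset.mem_sdiff] at hu
    rw [Finset.mem_sdiff, Finset.mem_sdiff, Finset.mem_insert, Finset.mem_singleton]
    refine ⟨⟨hQG hu.2.1, hu.2.2⟩, ?_⟩
    rintro (rfl | rfl)
    · exact hu.1 rfl
    · exact hxQ hu.2.1
  have hpG : p ∈ G := hQG (Finset.mem_sdiff.1 (Finset.mem_of_mem_erase hp)).1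
  have hqG : q ∈ G := hQG (Finset.mem_sdiff.1 (Finset.mem_of_mem_erase hq)).1
  have hy₂G : y₂ ∈ G := (Finset.mem_sdiff.1 (Finset.mem_of_mem_erase hy₂)).1
  have hy₂cl : y₂ ∈ clF M {p, q} := mem_clF_pair_of_rkN_le_two hG hs hpG hqG hy₂G hpq.symm hline
  set L := ((G \ insert z B).erase x).filter (fun y => rkN M (insert y {p, q}) ≤ 2) with hL
  by_contra hcard
  obtain ⟨u, v, hu, hv, huv⟩ := Finset.one_lt_card_iff.1 (show 1 < (L.erase y₂).card by omega)
  have hu' := Finset.mem_filter.1 (Finset.mem_of_mem_erase hu)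
  have hv' := Finset.mem_filter.1 (Finset.mem_of_mem_erase hv)
  have huy : u ≠ y₂ := (Finset.mem_erase.1 hu).1
  have hvy : v ≠ y₂ := (Finset.mem_erase.1 hv).1
  have huG : u ∈ G := (Finset.mem_sdiff.1 (Finset.mem_of_mem_erase hu'.1)).1
  have hvG : v ∈ G := (Finset.mem_sdiff.1 (Finset.mem_of_mem_erase hv'.1)).1
  have hucl : u ∈ clF M {p, q} := by
    have := hu'.2
    rw [insert_pair_eq'] at this
    exact mem_clF_pair_of_rkN_le_two hG hs hpG hqG huG hpq.symm this
  have hvcl : v ∈ clF M {p, q} := by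
    have := hv'.2
    rw [insert_pair_eq'] at this
    exact mem_clF_pair_of_rkN_le_two hG hs hpG hqG hvG hpq.symm this
  -- the five points `p, q, y₂, u, v` form a rank-2 set in `H₀`, hence inside `π₂`
  set S : Finset α := {p, q, y₂, u, v} with hS
  have hSV : S ⊆ (G \ coloops M G) \ {w₀, x} := by
    intro e he
    rw [hS, Finset.mem_insert, Finset.mem_insert, Finset.mem_insert, Finset.mem_insert, Finset.mem_singleton] at he
    rcases he with rfl | rfl | rfl | rfl | rfl
    · exact hP₀V _ hp
    · exact hP₀V _ hq
    · exact hWV _ hy₂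
    · exact hWV _ hu'.1
    · exact hWV _ hv'.1
  have hSg : S ⊆ gr M := hSV.trans hVg
  have hScl : S ⊆ clF M {p, q} := by
    intro e he
    rw [hS, Finset.mem_insert, Finset.mem_insert, Finset.mem_insert, Finset.mem_insert, Finset.mem_singleton] at he
    have hpqg : ({p, q} : Finset α) ⊆ gr M := by
      intro e he
      rw [Finset.mem_insert, Finset.mem_singleton] at he
      rcases he with rfl | rfl
      · exact hGg hpG
      · exact hGg hqG
    rcases he with rfl | rfl | rfl | rfl | rfl
    · exact subset_clF_of_subset_gr hpqg (Finset.mem_insert_self _ _)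
    · exact subset_clF_of_subset_gr hpqg (Finset.mem_insert_of_mem (Finset.mem_singleton_self _))
    · exact hy₂cl
    · exact hucl
    · exact hvcl
  have hS2 : rkN M S ≤ 2 := by
    have := rkN_mono (M := M) hScl
    rw [rkN_clF, hs p (hGg hpG) q (hGg hqG) hpq] at this
    exact this
  have hS3 : 3 ≤ S.card := by
    have hsub : ({p, q, y₂} : Finset α) ⊆ S := by
      intro e he
      rw [Finset.mem_insert, Finset.mem_insert, Finset.mem_singleton] at he
      rw [hS, Finset.mem_insert, Finset.mem_insert, Finset.mem_insert]
      rcases he with rfl | rfl | rfl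
      · exact Or.inl rfl
      · exact Or.inr (Or.inl rfl)
      · exact Or.inr (Or.inr (Or.inl rfl))
    have h := Finset.card_le_card hsub
    have hy₂p : y₂ ≠ p := fun h' => (Finset.mem_sdiff.1 (Finset.mem_of_mem_erase hy₂)).2
      (h' ▸ (Finset.mem_sdiff.1 (Finset.mem_of_mem_erase hp)).1)
    have hy₂q : y₂ ≠ q := fun h' => (Finset.mem_sdiff.1 (Finset.mem_of_mem_erase hy₂)).2
      (h' ▸ (Finset.mem_sdiff.1 (Finset.mem_of_mem_erase hq)).1)
    rw [Finset.card_insert_of_notMem, Finset.card_pair hy₂q.symm] at h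
    · exact h
    · rw [Finset.mem_insert, Finset.mem_singleton, not_or]
      exact ⟨hpq, hy₂p.symm⟩
  have hSπ : S ⊆ clF M (insert c₂ R₁) := by
    rcases subset_plane_of_rkN_le_two_of_cover hs hSg hS2 hS3 (fun e he => hcover e (hSV he)) with h | h
    · exact h
    · exfalso
      have hy₂S : y₂ ∈ S := by
        rw [hS, Finset.mem_insert, Finset.mem_insert, Finset.mem_insert]
        exact Or.inr (Or.inr (Or.inl rfl))
      exact hy₂L (mem_clF_of_mem_two_planes hR₁g hc₂g hc₃g hc₂ hc₃ hy₂2 (h hy₂S))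
  -- `u, v` are on the spine (they are in `π₂` and not `y₂`)
  have huL : u ∈ clF M R₁ := by
    by_contra hL
    exact huy (hA1 u hu'.1 (hSπ (by rw [hS]; simp)) hL)
  have hvL : v ∈ clF M R₁ := by
    by_contra hL
    exact hvy (hA1 v hv'.1 (hSπ (by rw [hS]; simp)) hL)
  -- so the line `clF {p, q}` is the spine, which contains `y₂`
  have huvL : ({u, v} : Finset α) ⊆ clF M R₁ := by
    intro e he
    rw [Finset.mem_insert, Finset.mem_singleton] at he
    rcases he with rfl | rfl
    · exact huL
    · exact hvL
  have hcl : clF M {u, v} = clF M R₁ :=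
    clF_eq_clF_of_subset_clF_of_rkN_le hR₁g huvL (by rw [hs u (hGg huG) v (hGg hvG) huv, hR₁2])
  have hpqcl : clF M {p, q} = clF M {u, v} := by
    have hsub : ({u, v} : Finset α) ⊆ clF M {p, q} := by
      intro e he
      rw [Finset.mem_insert, Finset.mem_singleton] at he
      rcases he with rfl | rfl
      · exact hucl
      · exact hvcl
    have hpqg : ({p, q} : Finset α) ⊆ gr M := by
      intro e he
      rw [Finset.mem_insert, Finset.mem_singleton] at he
      rcases he with rfl | rfl
      · exact hGg hpG
      · exact hGg hqG
    exact (clF_eq_clF_of_subset_clF_of_rkN_le hpqg hsub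
      (by rw [hs u (hGg huG) v (hGg hvG) huv, hs p (hGg hpG) q (hGg hqG) hpq])).symm
  apply hy₂L
  rw [← hcl, ← hpqcl]
  exact hy₂cl

/-- **A point of `W ∖ {x}` off the spine and on no basis line is free** (at most one basis point on the spine): every
target through `x` and it is unloaded. -/
theorem dload_eq_zero_through_free_off_spine (hG : G ∈ flatsQ M (5 + 1)) (hd : (gr M \ G).card = 2)
    (hk : kColoops M G = 1) (hs : ∀ e ∈ gr M, ∀ f ∈ gr M, e ≠ f → rkN M {e, f} = 2)
    (hl : ∀ e ∈ gr M, M.Indep {e}) (hfat : (fatClosures M 5 G 2).card ≤ 1) {B₀ : Finset α}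
    (hB₀ : B₀ ∈ thinMembers M 5 G) {w₀ x : α} (hD : G \ clF M B₀ = {w₀, x}) {R₁ : Finset α}
    (hR₁V : R₁ ⊆ (G \ coloops M G) \ {w₀, x}) (hR₁2 : rkN M R₁ = 2) (hR₁3 : 3 ≤ R₁.card) {c₂ c₃ : α}
    (hc₂V : c₂ ∈ (G \ coloops M G) \ {w₀, x}) (hc₃V : c₃ ∈ (G \ coloops M G) \ {w₀, x})
    (hc₂ : c₂ ∉ clF M R₁) (hc₃ : c₃ ∉ clF M (insert c₂ R₁))
    (hcover : ∀ e ∈ (G \ coloops M G) \ {w₀, x}, e ∈ clF M (insert c₂ R₁) ∨ e ∈ clF M (insert c₃ R₁))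
    (hnd₂ : 3 ≤ rkN M (((G \ coloops M G) \ {w₀, x}).filter
      (fun e => e ∈ clF M (insert c₂ R₁) ∧ e ∉ clF M R₁)))
    (hnd₃ : 3 ≤ rkN M (((G \ coloops M G) \ {w₀, x}).filter
      (fun e => e ∈ clF M (insert c₃ R₁) ∧ e ∉ clF M R₁)))
    {B : Finset α} (hB : B ∈ thinMembers M 5 G) (hnP : ¬ bigP M G B) {z : α} (hz : z ∈ G \ clF M B)
    (hxQ : x ∉ insert z B) {a : α} (hP₀ : ∀ e ∈ insert z B \ coloops M G, e ∈ clF M R₁ → e = a)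
    {y : α} (hy : y ∈ (G \ insert z B).erase x) (hyL : y ∉ clF M R₁)
    (hfree : ∀ p ∈ (insert z B \ coloops M G).erase w₀, ∀ q ∈ (insert z B \ coloops M G).erase w₀, p ≠ q →
      rkN M {p, q, y} = 3)
    {T : Finset α} (hT : T ∈ tgtSets M 5 G B z) (hxT : x ∈ T) (hyT : y ∈ T) :
    dload M 5 G (bigP M G) (dshGT2 M 5 G) T = 0 := by
  by_contra hload
  obtain ⟨R, hR, hR2, hR3, hRc, -⟩ := d1_through_off_spine_of_one_basis_point hG hd hk hs hl hfat hB₀ hD hR₁V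
    hR₁2 hR₁3 hc₂V hc₃V hc₂ hc₃ hcover hnd₂ hnd₃ hB hnP hz hxQ hP₀ hy hyL T hT hxT hyT hload
  obtain ⟨p, hp, q, hq, hpq, hrk⟩ :=
    exists_basis_line_of_dist_one_fat hG hd hk hs hB hnP hz hT hxT hxQ hR hR2 hRc
  have hyY : y ∈ (T \ insert z B).erase x :=
    Finset.mem_erase.2 ⟨(Finset.mem_erase.1 hy).1, Finset.mem_sdiff.2 ⟨hyT,
      (Finset.mem_sdiff.1 (Finset.mem_of_mem_erase hy)).2⟩⟩
  have hsub : ({p, q, y} : Finset α) ⊆ insert p (insert q ((T \ insert z B).erase x)) := by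
    intro e he
    rw [Finset.mem_insert, Finset.mem_insert, Finset.mem_singleton] at he
    rw [Finset.mem_insert, Finset.mem_insert]
    rcases he with rfl | rfl | rfl
    · exact Or.inl rfl
    · exact Or.inr (Or.inl rfl)
    · exact Or.inr (Or.inr hyY)
  have h1 := rkN_mono (M := M) hsub
  rw [hrk, hfree p hp q hq hpq] at h1
  omega

/-- **One basis point on the spine, `N = 6`**: the unique point `y₂` of `W ∖ {x}` in `π₂` off the spine, two spine points
`s, s'` and two points `q, q'` of `π₃` off the spine; level `1`, the six unloaded pairs `{y₂, s, s'} × {q, q'}` and the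
levels `4, 5, 6`. -/
theorem basis_pair_fair_fat_of_two_planes_one_six (hG : G ∈ flatsQ M (5 + 1)) (hd : (gr M \ G).card = 2)
    (hk : kColoops M G = 1) (hs : ∀ e ∈ gr M, ∀ f ∈ gr M, e ≠ f → rkN M {e, f} = 2)
    (hl : ∀ e ∈ gr M, M.Indep {e}) (hfat : (fatClosures M 5 G 2).card ≤ 1)
    {B₀ : Finset α} (hB₀ : B₀ ∈ thinMembers M 5 G) {w₀ x : α} (hD : G \ clF M B₀ = {w₀, x}) (hne : w₀ ≠ x) {R₁ : Finset α}
    (hR₁V : R₁ ⊆ (G \ coloops M G) \ {w₀, x}) (hR₁2 : rkN M R₁ = 2) (hR₁3 : 3 ≤ R₁.card) {c₂ c₃ : α}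
    (hc₂V : c₂ ∈ (G \ coloops M G) \ {w₀, x}) (hc₃V : c₃ ∈ (G \ coloops M G) \ {w₀, x})
    (hc₂ : c₂ ∉ clF M R₁) (hc₃ : c₃ ∉ clF M (insert c₂ R₁))
    (hcover : ∀ e ∈ (G \ coloops M G) \ {w₀, x}, e ∈ clF M (insert c₂ R₁) ∨ e ∈ clF M (insert c₃ R₁))
    (hnd₂ : 3 ≤ rkN M (((G \ coloops M G) \ {w₀, x}).filter
      (fun e => e ∈ clF M (insert c₂ R₁) ∧ e ∉ clF M R₁)))
    (hnd₃ : 3 ≤ rkN M (((G \ coloops M G) \ {w₀, x}).filter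
      (fun e => e ∈ clF M (insert c₃ R₁) ∧ e ∉ clF M R₁)))
    (hL3 : (((G \ coloops M G) \ {w₀, x}).filter (fun e => e ∈ clF M R₁)).card ≤ 3)
    {B : Finset α} (hB : B ∈ thinMembers M 5 G) (hnP : ¬ bigP M G B) {z : α} (hz : z ∈ G \ clF M B)
    (hl0 : loss M 5 G B z ≠ 0) (hw₀ : w₀ ∈ insert z B) (hx : x ∉ insert z B) (hN : (G \ insert z B).card = 6)
    {a d : α}
    (haP : a ∈ (insert z B \ coloops M G).erase w₀) (haL : a ∈ clF M R₁)
    (hP₀a : ∀ e ∈ insert z B \ coloops M G, e ∈ clF M R₁ → e = a)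
    (hdP : d ∈ (insert z B \ coloops M G).erase w₀) (hdL : d ∉ clF M R₁)
    (hP₀d : ∀ e ∈ insert z B \ coloops M G, e ∈ clF M (insert c₃ R₁) → e ∉ clF M R₁ → e = d)
    {y₂ s s' q q' : α} (hy₂ : y₂ ∈ (G \ insert z B).erase x) (hy₂2 : y₂ ∈ clF M (insert c₂ R₁))
    (hy₂L : y₂ ∉ clF M R₁) (hsW : s ∈ (G \ insert z B).erase x) (hsL : s ∈ clF M R₁)
    (hs'W : s' ∈ (G \ insert z B).erase x) (hs'L : s' ∈ clF M R₁) (hss' : s ≠ s')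
    (hqW : q ∈ (G \ insert z B).erase x) (hq3 : q ∈ clF M (insert c₃ R₁)) (hqL : q ∉ clF M R₁)
    (hq'W : q' ∈ (G \ insert z B).erase x) (hq'3 : q' ∈ clF M (insert c₃ R₁)) (hq'L : q' ∉ clF M R₁)
    (hqq' : q ≠ q') :
    loss M 5 G B z ≤ rhoL M 5 G B z * lossIncomeH M 5 G (bigP M G) (dshGT2 M 5 G) B z := by
  have hd' : (gr M \ G).card ≤ 5 := by omega
  have hGg : G ⊆ gr M := (mem_flatsQ.1 hG).1
  have hxG : x ∈ G \ insert z B := by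
    refine Finset.mem_sdiff.2 ⟨?_, hx⟩
    have : x ∈ G \ clF M B₀ := by
      rw [hD]
      exact Finset.mem_insert_of_mem (Finset.mem_singleton_self _)
    exact (Finset.mem_sdiff.1 this).1
  have hVg : (G \ coloops M G) \ {w₀, x} ⊆ gr M := fun e he =>
    hGg (Finset.mem_sdiff.1 (Finset.mem_sdiff.1 he).1).1
  have hR₁g : R₁ ⊆ gr M := hR₁V.trans hVg
  have hc₂g : c₂ ∈ gr M := hVg hc₂V
  have hc₃g : c₃ ∈ gr M := hVg hc₃V
  -- the six pairs
  set U : Finset α := {y₂, s, s'} with hU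
  set V : Finset α := {q, q'} with hV
  have hUW : U ⊆ (G \ insert z B).erase x := by
    intro e he
    rw [hU, Finset.mem_insert, Finset.mem_insert, Finset.mem_singleton] at he
    rcases he with rfl | rfl | rfl
    · exact hy₂
    · exact hsW
    · exact hs'W
  have hVW : V ⊆ (G \ insert z B).erase x := by
    intro e he
    rw [hV, Finset.mem_insert, Finset.mem_singleton] at he
    rcases he with rfl | rfl
    · exact hqW
    · exact hq'W
  have hUV : Disjoint U V := by
    rw [Finset.disjoint_left]
    intro e heU heV
    rw [hU, Finset.mem_insert, Finset.mem_insert, Finset.mem_singleton] at heU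
    rw [hV, Finset.mem_insert, Finset.mem_singleton] at heV
    rcases heV with rfl | rfl
    · rcases heU with h | h | h
      · subst h
        exact hqL (mem_clF_of_mem_two_planes hR₁g hc₂g hc₃g hc₂ hc₃ hy₂2 hq3)
      · subst h
        exact hqL hsL
      · subst h
        exact hqL hs'L
    · rcases heU with h | h | h
      · subst h
        exact hq'L (mem_clF_of_mem_two_planes hR₁g hc₂g hc₃g hc₂ hc₃ hy₂2 hq'3)
      · subst h
        exact hq'L hsL
      · subst h
        exact hq'L hs'L
  have hload : ∀ p ∈ U ×ˢ V, dload M 5 G (bigP M G) (dshGT2 M 5 G) (insert z B ∪ {x, p.1, p.2}) = 0 := by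
    intro p hp
    have hpUV := Finset.mem_product.1 hp
    rw [hU, Finset.mem_insert, Finset.mem_insert, Finset.mem_singleton] at hpUV
    have hp2W : p.2 ∈ (G \ insert z B).erase x := hVW hpUV.2
    have hp23 : p.2 ∈ clF M (insert c₃ R₁) ∧ p.2 ∉ clF M R₁ := by
      have := hpUV.2
      rw [hV, Finset.mem_insert, Finset.mem_singleton] at this
      rcases this with rfl | rfl
      · exact ⟨hq3, hqL⟩
      · exact ⟨hq'3, hq'L⟩
    rcases hpUV.1 with h | h | h
    · -- a cross pair
      rw [h]
      have hTt : insert z B ∪ {x, y₂, p.2} ∈ tgtSets M 5 G B z := by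
        have hBm : B ∈ membersIn M (Uq M (5 + 2) 5) G := (mem_thinMembers.1 hB).1
        rw [tgtSets_eq_image hG hBm hz, Finset.mem_image]
        refine ⟨{x, y₂, p.2}, Finset.mem_filter.2 ⟨Finset.mem_powerset.2 ?_, ⟨x, Finset.mem_insert_self _ _⟩⟩, rfl⟩
        intro e he
        rw [Finset.mem_insert, Finset.mem_insert, Finset.mem_singleton] at he
        rcases he with rfl | rfl | rfl
        · exact hxG
        · exact Finset.mem_of_mem_erase hy₂
        · exact Finset.mem_of_mem_erase hp2W
      have hmem : ∀ e ∈ ({y₂, p.2} : Finset α), e ∈ ((insert z B ∪ {x, y₂, p.2}) \ insert z B).erase x := by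
        intro e he
        rw [Finset.mem_insert, Finset.mem_singleton] at he
        have heW : e ∈ (G \ insert z B).erase x := by
          rcases he with rfl | rfl
          · exact hy₂
          · exact hp2W
        refine Finset.mem_erase.2 ⟨(Finset.mem_erase.1 heW).1, Finset.mem_sdiff.2 ⟨?_,
          (Finset.mem_sdiff.1 (Finset.mem_of_mem_erase heW)).2⟩⟩
        rw [Finset.mem_union]
        rcases he with rfl | rfl
        · exact Or.inr (Finset.mem_insert_of_mem (Finset.mem_insert_self _ _))
        · exact Or.inr (Finset.mem_insert_of_mem (Finset.mem_insert_of_mem (Finset.mem_singleton_self _)))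
      exact dload_eq_zero_of_cross_pair hG hd hk hs hl hfat hB₀ hD hR₁V hR₁2 hR₁3 hc₂V hc₃V hc₂ hc₃ hcover hnd₂ hnd₃
        hB hnP hz hx hTt (Finset.mem_union_right _ (Finset.mem_insert_self _ _))
        (hmem y₂ (Finset.mem_insert_self _ _)) (hmem p.2 (Finset.mem_insert_of_mem (Finset.mem_singleton_self _)))
        hy₂2 hy₂L hp23.1 hp23.2
    · rw [h]
      exact dload_eq_zero_of_spine_plane_pair hG hd hk hs hl hfat hB₀ hD hR₁V hR₁2 hR₁3 hc₂V hc₃V hc₂ hc₃ hcover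
        hnd₂ hnd₃ hB hnP hz hw₀ hxG haP haL hP₀a hdP hdL hP₀d hsW hsL hp2W hp23.1 hp23.2
    · rw [h]
      exact dload_eq_zero_of_spine_plane_pair hG hd hk hs hl hfat hB₀ hD hR₁V hR₁2 hR₁3 hc₂V hc₃V hc₂ hc₃ hcover
        hnd₂ hnd₃ hB hnP hz hw₀ hxG haP haL hP₀a hdP hdL hP₀d hs'W hs'L hp2W hp23.1 hp23.2
  have hl3 := card_pairs_le_unloaded_level_three_sum hG hd hk hB hnP hz hxG hUW hVW hUV (Finset.Subset.refl _) hload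
  have hUc : U.card = 3 := by
    rw [hU, Finset.card_insert_of_notMem, Finset.card_pair hss']
    rw [Finset.mem_insert, Finset.mem_singleton, not_or]
    exact ⟨fun h' => hy₂L (h' ▸ hsL), fun h' => hy₂L (h' ▸ hs'L)⟩
  have hVc : V.card = 2 := Finset.card_pair hqq'
  rw [Finset.card_product, hUc, hVc, hN] at hl3
  -- the top levels
  have htop : ∀ T ∈ tgtSets M 5 G B z, x ∈ T → 4 ≤ (T \ insert z B).card →
      dload M 5 G (bigP M G) (dshGT2 M 5 G) T = 0 := by
    intro T hT _ h4
    have hTG : T ⊆ G := subset_G_of_mem_shadowAt (mem_tgtSets.1 hT).1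
    have hGT := card_sdiff_add_card_sdiff_of_mem_tgtSets hT
    have hsub : ((T \ coloops M G) \ {w₀, x}).filter (fun e => e ∈ clF M R₁) ⊆
        ((G \ coloops M G) \ {w₀, x}).filter (fun e => e ∈ clF M R₁) :=
      Finset.filter_subset_filter _
        (Finset.sdiff_subset_sdiff (Finset.sdiff_subset_sdiff hTG (Finset.Subset.refl _)) (Finset.Subset.refl _))
    have := Finset.card_le_card hsub
    exact dload_eq_zero_of_top_of_spine_le hG hd hk hs hl hfat hB₀ hD hR₁V hR₁2 hR₁3 hc₂V hc₃V hc₂ hc₃ hcover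
      hnd₂ hnd₃ hB hnP hz hT (by omega) (by omega)
  have hl1 := fat_count_level_ge' hG hd hk hB hnP hz hxG (j := 1) (by norm_num)
    (fun T hT _ h1 => dload_eq_zero_of_card_sdiff_le_six hG hd hk hs hl
      (by rw [card_sdiff_coloops_eq_level_add_five hG hd hk hB hnP hz hT, h1]))
  have hl4 := fat_count_level_ge' hG hd hk hB hnP hz hxG (j := 4) (by norm_num)
    (fun T hT hxT h4 => htop T hT hxT (by omega))
  have hl5 := fat_count_level_ge' hG hd hk hB hnP hz hxG (j := 5) (by norm_num)
    (fun T hT hxT h5 => htop T hT hxT (by omega))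
  have hl6 := fat_count_level_ge' hG hd hk hB hnP hz hxG (j := 6) (by norm_num)
    (fun T hT hxT h6 => htop T hT hxT (by omega))
  rw [hN] at hl1 hl4 hl5 hl6
  have hg0 : ∀ T ∈ (tgtSets M 5 G B z).filter
      (fun T => x ∈ T ∧ dload M 5 G (bigP M G) (dshGT2 M 5 G) T = 0),
      0 ≤ capS M 5 G T / ((221 / 360 : ℚ) * ((2 * ((T \ coloops M G).card - 2).choose 4 : ℕ) : ℚ)) :=
    fun T _ => div_nonneg (capS_nonneg' hG hd' T) (by positivity)
  apply basis_pair_fair_of_fat_count_sum hG hd hk hs hl hfat hB₀ hD hne hB hnP hz hl0 hw₀ hx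
  have hsum := sum_levels_le_sum hg0 (fun T => (T \ insert z B).card) {1, 3, 4, 5, 6}
  rw [Finset.sum_insert (by decide), Finset.sum_insert (by decide), Finset.sum_insert (by decide),
    Finset.sum_insert (by decide), Finset.sum_singleton] at hsum
  have hnum : (1 : ℚ) ≤ (((6 - 1).choose (1 - 1) : ℕ) : ℚ) * fatTerm 1 (if 6 - 1 ≤ 3 then 1 else 11 / 18) +
      (((3 * 2 : ℕ) : ℚ) * fatTerm 3 (if 6 - 3 ≤ 3 then 1 else 11 / 18) +
      (((6 - 1).choose (4 - 1) : ℕ) : ℚ) * fatTerm 4 (if 6 - 4 ≤ 3 then 1 else 11 / 18) +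
      (((6 - 1).choose (5 - 1) : ℕ) : ℚ) * fatTerm 5 (if 6 - 5 ≤ 3 then 1 else 11 / 18) +
      (((6 - 1).choose (6 - 1) : ℕ) : ℚ) * fatTerm 6 (if 6 - 6 ≤ 3 then 1 else 11 / 18)) := by
    unfold fatTerm
    norm_num [Nat.choose]
  linarith

end PercRepro.Shadow
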